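import Mathlib
import Summits.Ventures.PercRepro2.A3FibreMain
import Summits.Ventures.PercRepro2.A3CutReduce
import Summits.Ventures.PercRepro2.A3CutReductionAll

/-!
# (MEANS-a₃) ∧ (FM) for all graphs reduce to the vertices not behind a cut vertex
(blind cell PercRepro2, night-1 g32; proofs/NIGHT1-G32.md §6 (E3))

The (MEANS-a₃)-line version of `HCov_all_of_leafRow_of_notBehindCut`, with NO open row as a hypothesis:
by `A3Between_cut_of_loopA` / `FM_cut_of_loopA` (x unmarked) and `A3Between_pendantPart_mark` /
`FM_pendantPart_mark` (x a mark), a strong induction on the number of non-loop edges gives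
(MEANS-a₃) ∧ (FM) at every vertex of every graph from (MEANS-a₃) ∧ (FM) at the vertices that are not
behind a cut vertex (`A3Between_and_FM_of_notBehindCut`); in the `_all` form,
`A3Between_all_of_notBehindCut` and `HCov_all_of_a3BetweenFM_notBehindCut`.  Standard axioms.
-/

namespace Summit.Ventures.PercRepro2

open UnionCluster CovForm CutV

namespace CovForm

namespace A3Fibre

section PendantReductionA3

variable {V : Type*} {E : Type*} [Fintype V] [DecidableEq V] [Fintype E] [DecidableEq E]
  {R : Type*} [Field R] [LinearOrder R] [IsStrictOrderedRing R]

/-- **The pendant-part reduction of (MEANS-a₃) ∧ (FM).** For a fixed weight `p`: if (MEANS-a₃) and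
(FM) hold at every vertex that is not behind a cut vertex, they hold everywhere. -/
theorem A3Between_and_FM_of_notBehindCut (p : E → R) (hp : IsProbVec p)
    (hbase : ∀ (ends : E → Sym2 V) (o a₁ a₂ a₃ b : V), a₁ ≠ a₂ → a₁ ≠ a₃ → a₂ ≠ a₃ → o ≠ a₁ →
      o ≠ a₂ → o ≠ a₃ → o ≠ b → b ≠ a₁ → b ≠ a₂ → b ≠ a₃ → ¬ BehindCut ends o a₁ a₂ a₃ b →
      A3Between p ends o a₁ a₂ a₃ b ∧ 0 ≤ FMfun p ends o a₁ a₂ a₃ b)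
    (ends : E → Sym2 V) (o a₁ a₂ a₃ b : V) (h12 : a₁ ≠ a₂) (h13 : a₁ ≠ a₃) (h23 : a₂ ≠ a₃)
    (ho1 : o ≠ a₁) (ho2 : o ≠ a₂) (ho3 : o ≠ a₃) (hob : o ≠ b) (hb1 : b ≠ a₁) (hb2 : b ≠ a₂)
    (hb3 : b ≠ a₃) : A3Between p ends o a₁ a₂ a₃ b ∧ 0 ≤ FMfun p ends o a₁ a₂ a₃ b := by
  suffices H : ∀ n : ℕ, ∀ (ends : E → Sym2 V) (a₃ : V),
      (Finset.univ.filter fun e => ¬ (ends e).IsDiag).card = n → a₁ ≠ a₃ → a₂ ≠ a₃ → o ≠ a₃ →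
      b ≠ a₃ → A3Between p ends o a₁ a₂ a₃ b ∧ 0 ≤ FMfun p ends o a₁ a₂ a₃ b from
    H _ ends a₃ rfl h13 h23 ho3 hb3
  intro n
  induction n using Nat.strong_induction_on with
  | _ n ih =>
    intro ends a₃ hn h13 h23 ho3 hb3
    by_cases hB : BehindCut ends o a₁ a₂ a₃ b
    · obtain ⟨x, VA, VB, EA, EB, h, h3, ho, h1, h2, hb, he⟩ := hB
      classical
      by_cases hx : x = o ∨ x = b ∨ x = a₁ ∨ x = a₂
      · exact ⟨A3Between_pendantPart_mark hp h hx ho h1 h2 hb h3,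
          FM_pendantPart_mark hp h hx ho h1 h2 hb h3⟩
      · simp only [not_or] at hx
        have hlt := card_nonLoop_loopA_lt (x := x) he
        rw [hn] at hlt
        obtain ⟨hA, hF⟩ := ih _ hlt (loopA ends EA x) x rfl (Ne.symm hx.2.2.1) (Ne.symm hx.2.2.2)
          (Ne.symm hx.1) (Ne.symm hx.2.1)
        exact ⟨A3Between_cut_of_loopA hp h ho h1 h2 hb h3 hA hF,
          FM_cut_of_loopA hp h ho h1 h2 hb h3 hF⟩
    · exact hbase ends o a₁ a₂ a₃ b h12 h13 h23 ho1 ho2 ho3 hob hb1 hb2 hb3 hB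

end PendantReductionA3

section Closure

variable (R : Type*) [Field R] [LinearOrder R] [IsStrictOrderedRing R]

/-- **(MEANS-a₃) ∧ (FM) for every finite graph at every `a₃` that is not behind a cut vertex.** -/
def A3BetweenFMNotBehindCut_all : Prop :=
  ∀ (V E : Type) [Fintype V] [DecidableEq V] [Fintype E] [DecidableEq E]
    (ends : E → Sym2 V) (p : E → R), IsProbVec p →
    ∀ o a₁ a₂ a₃ b : V, a₁ ≠ a₂ → a₁ ≠ a₃ → a₂ ≠ a₃ → o ≠ a₁ → o ≠ a₂ → o ≠ a₃ → o ≠ b →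
      b ≠ a₁ → b ≠ a₂ → b ≠ a₃ → ¬ BehindCut ends o a₁ a₂ a₃ b →
      A3Between p ends o a₁ a₂ a₃ b ∧ 0 ≤ FMfun p ends o a₁ a₂ a₃ b

/-- **(MEANS-a₃) for all graphs from (MEANS-a₃) ∧ (FM) off the pendant parts.** -/
theorem A3Between_all_of_notBehindCut (h : A3BetweenFMNotBehindCut_all R) : A3Between_all R := by
  intro V E _ _ _ _ ends p hp o a₁ a₂ a₃ b h12 h13 h23 ho1 ho2 ho3 hob hb1 hb2 hb3
  exact (A3Between_and_FM_of_notBehindCut p hp (fun ends' => h V E ends' p hp) ends o a₁ a₂ a₃ b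
    h12 h13 h23 ho1 ho2 ho3 hob hb1 hb2 hb3).1

/-- **(HCOV) for all graphs from (MEANS-a₃) ∧ (FM) off the pendant parts.** -/
theorem HCov_all_of_a3BetweenFM_notBehindCut (h : A3BetweenFMNotBehindCut_all R) : HCov_all R :=
  HCov_all_of_a3Between_all R (A3Between_all_of_notBehindCut R h)

end Closure

end A3Fibre

end CovForm

end Summit.Ventures.PercRepro2
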